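import Summits.QuantumFields.QCD.Theorems.WilsonMobilityGapMobilityGapCriticalMassOrder
import Summits.QuantumFields.QCD.Theorems.WilsonMobilityGapMobilityGapSketchFreeReduction

/-!
# Crux `MobilityGap` (stmt-QuantumFields-9150), line `Sketch` — light channels are supercritical up to `O(a_k)`

Support file (`--supports stmt-QuantumFields-9150`, registered sub-goal `lightMomentFree_order`) of line
`Sketch`, lead c3 (cycle 4).  Sorry-free.

The infrared stub of the line (`stub_lightFree` = `LightMomentFree N_f` unfolded: along SOME admissible
data some bare mass `x > -1` carries an `a_k`-light channel, `c e^{-r a_k n} ≤ fm(β_k, x, S, f, n e₀, s)`) is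
necessary for the crux (`lightMomentFree_of_mobilityGap`).  With the light-positive-mass bound
`MobilityGapCriticalMassOrder.fm_le_of_pos` (`fm ≤ (144/x)^s e^{-s log(1+x/4) n}` for `x > 0`, uniformly in
the coupling, the torus and the field) the light point is pinned from above:

* `lightPoint_le_of_lightBound` — at ONE step: a bare mass `x` carrying the bound
  `c e^{-r a n} ≤ fm(β, x, S, f, n e₀, s)` for all `S ≥ S₀`, `n ≤ S` (`c > 0`, `s ∈ (0,1)`) satisfies
  `x ≤ max 0 (4 (exp (r a / s) − 1))` (`no_rate_sandwich` with `p = 0`).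
* `lightMomentAt_order` — along data with `a_k → 0`: the light points of `LightMomentAt N_f a β s` can be
  taken `≤ K a_k`, `K = 8|r|/s`.
* `lightMomentFree_order` (registered sub-goal) — `LightMomentFree N_f` is equivalent to its sharpening
  with the extra conjunct `x ≤ K a_k`: the light channel, wherever it exists, lives in the closed
  supercritical region `κ ≥ 1/8 − O(a_k)` of Wilson fermions — the regime without any background-uniform
  resolvent bound, which is why the stub is open-problem class and not a hopping-expansion exercise.

* `exp_mem_floorSetD`, `thrD_le_exp`, `thrD_eventually_le` — the SAME bound sharpens the line's heavy anchor
  (`anchorD`: the floor `1/10` is good, `thrD ≤ 1/10`) to: for every rate `δ > 0`, eventually in `k`, the floor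
  `144 e^{-δ/d.s}` is good, so `thrD d δ k ≤ 144 e^{-δ/d.s}`; hence for every `ε > 0`, for all large `δ`,
  eventually in `k`, `thrD d δ k ≤ ε` — the line's own `m_crit(k) := thrD d δ k` is asymptotically `≤ 0⁺` in the
  limit the composition takes (`∀ᶠ δ`), with floor-set non-emptiness for EVERY `δ > 0`.

References: I. Montvay, G. Münster, *Quantum Fields on a Lattice* (CUP 1994), §5.1.2 [MontvayMunster1994].
-/

noncomputable section

namespace Summit.QuantumFields.QCD.Theorems.MobilityGapSketch

open scoped BigOperators Topology
open MeasureTheory Filter Set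
open Literature.MathematicalPhysics.QuantumFieldTheory Literature.MathematicalPhysics.QuantumLattice
  Literature.Probability.LatticeModels

variable {Nf : ℕ}

/-- The line's `fm` and the negative side's `fm` are the same functional (definitional). -/
theorem fm_eq_negative_fm : @fm = @MobilityGapNegative.fm := rfl

/-- **A light point is at most `max 0 (4 (exp (r a / s) − 1))`.**  If at coupling `β` the degenerate
tuple at bare mass `x` carries the lower bound `c e^{-r a n} ≤ fm(β, x, S, f, n e₀, s)` for all tori
`S ≥ S₀` and all `n ≤ S` (`c > 0`, `0 < s < 1`), then `x ≤ max 0 (4 (exp (r a / s) − 1))`: otherwise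
`x > 0` with `ℓ²` lattice rate `s log(1 + x/4) > r a`, and `MobilityGapCriticalMassOrder.fm_le_of_pos`
closes a rate sandwich excluded by `no_rate_sandwich`. -/
theorem lightPoint_le_of_lightBound {Nf : ℕ} {β x s r c a : ℝ} {f : Fin Nf} {S₀ : ℕ}
    (hs0 : 0 < s) (hs1 : s < 1) (hc : 0 < c)
    (h : ∀ S : ℕ, S₀ ≤ S → ∀ n : ℕ, n ≤ S →
      c * Real.exp (-(r * (a * n))) ≤ fm Nf β (fun _ => x) S f (Pi.single 0 (n : ℤ)) s) :
    x ≤ max 0 (4 * (Real.exp (r * a / s) - 1)) := by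
  by_contra hne
  rw [not_le, max_lt_iff] at hne
  obtain ⟨hpos, hlt⟩ := hne
  have h1 : Real.exp (r * a / s) < 1 + x / 4 := by linarith
  have h2 : r * a / s < Real.log (1 + x / 4) := by
    have := Real.log_lt_log (Real.exp_pos _) h1
    rwa [Real.log_exp] at this
  have h3 : r * a < s * Real.log (1 + x / 4) := by
    have := mul_lt_mul_of_pos_left h2 hs0
    rwa [mul_div_cancel₀ _ hs0.ne'] at this
  refine MobilityGapNegative.no_rate_sandwich (A := r * a) (B := s * Real.log (1 + x / 4))
    (C := (144 / x) ^ s) (p := 0) hc h3 S₀ fun n hn => ?_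
  have hlow := h n hn n le_rfl
  have hup := MobilityGapCriticalMassOrder.fm_le_of_pos Nf β (fun _ : Fin Nf => x) f hpos n hs0 hs1 _
    (MobilityGapNegative.single_mem_box n)
  rw [MobilityGapNegative.norm_single_natCast] at hup
  have e : c * Real.exp (-(r * a * (n : ℝ) + 0 * Real.log (n + 1))) = c * Real.exp (-(r * (a * n))) := by
    rw [zero_mul, add_zero, mul_assoc]
  rw [e]
  exact hlow.trans (fm_eq_negative_fm ▸ hup)

/-- **Light points along data with `a_k > 0`, `a_k → 0` are `≤ K a_k`.**  For `LightMomentAt N_f a β s`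
with `0 < s < 1` there are a rate `r` and `K = 8|r|/s ≥ 0` such that eventually in `k` the light point
can be taken in `(-1, K a_k]`. -/
theorem lightMomentAt_order {Nf : ℕ} {a β : ℕ → ℝ} {s : ℝ} (hapos : ∀ k, 0 < a k)
    (ha : Tendsto a atTop (𝓝 0)) (hs0 : 0 < s) (hs1 : s < 1) (h : LightMomentAt Nf a β s) :
    ∃ r K : ℝ, 0 ≤ K ∧ ∀ᶠ k in atTop, ∃ x : ℝ, -1 < x ∧ x ≤ K * a k ∧ ∃ (f : Fin Nf) (c : ℝ), 0 < c ∧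
      ∃ S₀ : ℕ, ∀ S : ℕ, S₀ ≤ S → ∀ n : ℕ, n ≤ S →
        c * Real.exp (-(r * (a k * n))) ≤ fm Nf (β k) (fun _ => x) S f (Pi.single 0 (n : ℤ)) s := by
  obtain ⟨r, hk⟩ := h
  refine ⟨r, 8 * |r| / s, by positivity, ?_⟩
  have hsmall : ∀ᶠ k in atTop, |r * a k / s| ≤ 1 := by
    have ht : Tendsto (fun k => r * a k / s) atTop (𝓝 (r * 0 / s)) := (ha.const_mul r).div_const s
    rw [mul_zero, zero_div] at ht
    have := ht.abs
    rw [abs_zero] at this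
    exact this.eventually (eventually_le_nhds one_pos)
  filter_upwards [hk, hsmall] with k hkk hsk
  obtain ⟨x, hx, f, c, hc, S₀, hS⟩ := hkk
  refine ⟨x, hx, ?_, f, c, hc, S₀, hS⟩
  have hle := lightPoint_le_of_lightBound (a := a k) hs0 hs1 hc hS
  refine hle.trans (max_le (by have := hapos k; positivity) ?_)
  refine (MobilityGapCriticalMassOrder.four_mul_exp_sub_one_le hsk).trans_eq ?_
  rw [abs_div, abs_mul, abs_of_pos hs0, abs_of_pos (hapos k)]
  ring

/-- **`LightMomentFree N_f` with the light point pinned to `(-1, K a_k]`** (registered sub-goal of crux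
stmt-QuantumFields-9150): the free infrared law of line `Sketch` (= its stub `stub_lightFree`) is
equivalent to the same law with the extra conjunct `x ≤ K a_k` for some `K ≥ 0` — an `a_k`-light channel
above the branch cut `-1` can only sit at or below the free critical point `κ = 1/8` up to `O(a_k)`. -/
theorem lightMomentFree_order : ∀ Nf : ℕ, LightMomentFree Nf →
    ∃ a β : ℕ → ℝ, (∀ k, 0 < a k) ∧ Tendsto a atTop (𝓝 0) ∧
      (∃ Λ > (0 : ℝ), Tendsto (fun k => β k - afBeta Nf Λ (a k)) atTop (𝓝 0)) ∧
        ∃ s : ℝ, 0 < s ∧ s < 1 ∧ ∃ r K : ℝ, 0 ≤ K ∧ ∀ᶠ k in atTop, ∃ x : ℝ, -1 < x ∧ x ≤ K * a k ∧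
          ∃ (f : Fin Nf) (c : ℝ), 0 < c ∧ ∃ S₀ : ℕ, ∀ S : ℕ, S₀ ≤ S → ∀ n : ℕ, n ≤ S →
            c * Real.exp (-(r * (a k * n))) ≤ fm Nf (β k) (fun _ => x) S f (Pi.single 0 (n : ℤ)) s := by
  intro Nf h
  obtain ⟨a, β, hapos, ha, hAF, s, hs0, hs1, hL⟩ := h
  exact ⟨a, β, hapos, ha, hAF, s, hs0, hs1, lightMomentAt_order hapos ha hs0 hs1 hL⟩

/-- Conversely the pinned form implies `LightMomentFree` (drop the conjunct): the two are equivalent. -/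
theorem lightMomentFree_iff_order (Nf : ℕ) : LightMomentFree Nf ↔
    ∃ a β : ℕ → ℝ, (∀ k, 0 < a k) ∧ Tendsto a atTop (𝓝 0) ∧
      (∃ Λ > (0 : ℝ), Tendsto (fun k => β k - afBeta Nf Λ (a k)) atTop (𝓝 0)) ∧
        ∃ s : ℝ, 0 < s ∧ s < 1 ∧ ∃ r K : ℝ, 0 ≤ K ∧ ∀ᶠ k in atTop, ∃ x : ℝ, -1 < x ∧ x ≤ K * a k ∧
          ∃ (f : Fin Nf) (c : ℝ), 0 < c ∧ ∃ S₀ : ℕ, ∀ S : ℕ, S₀ ≤ S → ∀ n : ℕ, n ≤ S →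
            c * Real.exp (-(r * (a k * n))) ≤ fm Nf (β k) (fun _ => x) S f (Pi.single 0 (n : ℤ)) s := by
  refine ⟨lightMomentFree_order Nf, ?_⟩
  rintro ⟨a, β, hapos, ha, hAF, s, hs0, hs1, r, K, -, hk⟩
  exact ⟨a, β, hapos, ha, hAF, s, hs0, hs1, r, hk.mono fun k ⟨x, hx, _, f, c, hc, S₀, hS⟩ =>
    ⟨x, hx, f, c, hc, S₀, hS⟩⟩

/-- **Crux-level corollary.**  `MobilityGap` implies the pinned free infrared law for `N_f = 2, 3`. -/
theorem lightMomentFree_order_of_mobilityGap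
    (h : Summit.QuantumFields.QCD.Theses.WilsonMobilityGap.MobilityGap) (Nf : ℕ) (hNf : Nf = 2 ∨ Nf = 3) :
    ∃ a β : ℕ → ℝ, (∀ k, 0 < a k) ∧ Tendsto a atTop (𝓝 0) ∧
      (∃ Λ > (0 : ℝ), Tendsto (fun k => β k - afBeta Nf Λ (a k)) atTop (𝓝 0)) ∧
        ∃ s : ℝ, 0 < s ∧ s < 1 ∧ ∃ r K : ℝ, 0 ≤ K ∧ ∀ᶠ k in atTop, ∃ x : ℝ, -1 < x ∧ x ≤ K * a k ∧
          ∃ (f : Fin Nf) (c : ℝ), 0 < c ∧ ∃ S₀ : ℕ, ∀ S : ℕ, S₀ ≤ S → ∀ n : ℕ, n ≤ S →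
            c * Real.exp (-(r * (a k * n))) ≤ fm Nf (β k) (fun _ => x) S f (Pi.single 0 (n : ℤ)) s :=
  lightMomentFree_order Nf (lightMomentFree_of_mobilityGap h Nf hNf)

/-! ### §2 The line's threshold is at most `144 e^{-δ/s}` eventually -/

/-- **Exponential anchor along a datum.**  For every rate `δ` (of interest: `δ > 0`), eventually in `k` (as soon as
`δ a_k ≤ d.s · log (1 + 36 e^{-δ/d.s})`), the floor `u_δ := 144 e^{-δ/d.s} > 0` is good: every tuple with all
components `≥ u_δ` is certified at `(d.s, δ, e^{δ})`, because `fm_le_of_pos` gives amplitude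
`(144/t_f)^{s} ≤ (144/u_δ)^{s} = e^{δ}` and lattice rate `s log(1 + t_f/4) ≥ s log(1 + u_δ/4) ≥ δ a_k`. -/
theorem exp_mem_floorSetD (d : LineData Nf) (δ : ℝ) :
    ∀ᶠ k in atTop, 144 * Real.exp (-δ / d.s) ∈ floorSetD d δ k := by
  set u : ℝ := 144 * Real.exp (-δ / d.s) with hu
  have hupos : 0 < u := by positivity
  have hlog : 0 < d.s * Real.log (1 + u / 4) :=
    mul_pos d.s_pos (Real.log_pos (by linarith [div_pos hupos four_pos]))
  have hrate : ∀ᶠ k in atTop, δ * d.a k ≤ d.s * Real.log (1 + u / 4) := by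
    have ht : Tendsto (fun k => δ * d.a k) atTop (𝓝 (δ * 0)) := d.tendsto_a.const_mul δ
    rw [mul_zero] at ht
    exact ht.eventually (eventually_le_nhds hlog)
  filter_upwards [hrate] with k hk
  refine ⟨by linarith, fun t ht _ S _ f v hv => ?_⟩
  have htf : 0 < t f := hupos.trans_le (ht f)
  have hb := MobilityGapCriticalMassOrder.fm_le_of_pos Nf (d.β k) t f htf S d.s_pos d.s_lt_one v hv
  rw [← fm_eq_negative_fm] at hb
  refine hb.trans (mul_le_mul ?_ ?_ (Real.exp_pos _).le (Real.exp_pos _).le)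
  · -- amplitude: `(144 / t f)^s ≤ (144 / u)^s = e^{δ}`
    have h1 : (144 / t f) ^ d.s ≤ (144 / u) ^ d.s :=
      Real.rpow_le_rpow (by positivity) (div_le_div_of_nonneg_left (by norm_num) hupos (ht f)) d.s_pos.le
    refine h1.trans_eq ?_
    rw [hu, ← div_div, div_self (by norm_num : (144 : ℝ) ≠ 0), one_div, ← Real.exp_neg,
      ← Real.exp_mul]
    congr 1
    rw [neg_div, neg_neg, div_mul_cancel₀ _ d.s_pos.ne']
  · -- rate: `s log(1 + t_f/4) ‖v‖ ≥ δ a_k ‖v‖`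
    apply Real.exp_le_exp.2
    have hv0 : 0 ≤ ‖v‖ := norm_nonneg _
    have h2 : d.s * Real.log (1 + u / 4) ≤ d.s * Real.log (1 + t f / 4) :=
      mul_le_mul_of_nonneg_left (Real.log_le_log (by positivity) (by linarith [ht f])) d.s_pos.le
    have h3 : δ * d.a k ≤ d.s * Real.log (1 + t f / 4) := hk.trans h2
    have h4 : δ * d.a k * ‖v‖ ≤ d.s * Real.log (1 + t f / 4) * ‖v‖ := mul_le_mul_of_nonneg_right h3 hv0
    have e1 : δ * (d.a k * ‖v‖) = δ * d.a k * ‖v‖ := by ring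
    rw [e1]
    linarith

/-- **The threshold along any datum is eventually `≤ 144 e^{-δ/d.s}`** (for every `δ > 0`), and the floor set is
non-empty (every `δ`) — the exponential sharpening of `thrD_le_tenth` / `floorSetD_nonempty`. -/
theorem thrD_le_exp (d : LineData Nf) (δ : ℝ) :
    ∀ᶠ k in atTop, (floorSetD d δ k).Nonempty ∧ thrD d δ k ≤ 144 * Real.exp (-δ / d.s) :=
  (exp_mem_floorSetD d δ).mono fun _ hk => ⟨⟨_, hk⟩, thrD_le_of_mem hk⟩

/-- **In the limit the composition takes, the line's `m_crit` is asymptotically non-positive**: for every `ε > 0`,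
for all large `δ`, eventually in `k`, `thrD d δ k ≤ ε`. -/
theorem thrD_eventually_le (d : LineData Nf) {ε : ℝ} (hε : 0 < ε) :
    ∀ᶠ δ in atTop, ∀ᶠ k in atTop, thrD d δ k ≤ ε := by
  -- `144 e^{-δ/s} ≤ ε` as soon as `δ ≥ s · log (144/ε)`; take `δ ≥ max 1 (s log(144/ε))`
  have hlim : Tendsto (fun δ : ℝ => 144 * Real.exp (-δ / d.s)) atTop (𝓝 (144 * 0)) := by
    refine tendsto_const_nhds.mul ?_
    refine Real.tendsto_exp_atBot.comp ?_
    have : Tendsto (fun δ : ℝ => δ / d.s) atTop atTop := tendsto_id.atTop_div_const d.s_pos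
    simpa [neg_div] using this
  rw [mul_zero] at hlim
  filter_upwards [hlim.eventually (eventually_le_nhds hε)] with δ hδε
  exact (thrD_le_exp d δ).mono fun k hk => hk.2.trans hδε

end Summit.QuantumFields.QCD.Theorems.MobilityGapSketch

end
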